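import Literature.AlgebraicGeometry.Morphisms.SectionsBaseChangeOfFibreVanishing
import Literature.Algebra.Homology.KerZeroOfQuasiIsoNatural
import Literature.AlgebraicGeometry.Modules.ModuleSectionsFlatBaseChange
import Literature.AlgebraicGeometry.Morphisms.SectionsBaseChangeOfFibreVanishingPoints
import Literature.AlgebraicGeometry.Morphisms.FormalFunctionsModuleComplete
import Mathlib.RingTheory.LocalProperties.Projective
import Mathlib.RingTheory.Localization.BaseChange
import HarnessLib

/-!
# `Γ(X, G)` is finitely generated projective when `H¹` of the fibres vanishes (Mumford §5 Cor. 2, degree `0`)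

[cite: MumfordAV1970, §5, Corollary 2 (p. 50) and Corollary 3 (p. 53)]
[cite: Hartshorne1977, III Theorem 12.11 (p. 290)]
[cite: EGAIII2, 7.8.4]

Sequel to ★ `Morphisms/SectionsBaseChangeOfFibreVanishing` (B-p19 (g14/g15): «`H⁰` commutes with every base change when
`H¹` of the closed fibre vanishes»).  That chain consumes conjunct `.2` of ★
`Literature.Algebra.Module.kerBaseChange_of_exact_residueField_one_complex` (base change of `Z⁰`); this file consumes its
conjunct `.1` — **`Z⁰` of the strictly perfect Grothendieck model is finitely generated PROJECTIVE** (Mumford §5 Cor. 2 /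
Hartshorne III 12.11 (b) at `i = 1`, then `i = 0`) — and carries it to the global sections `Γ(X, G)`:

* §1 `finite_and_projective_secMod_top_of_exact_one` — `g : X → B` proper flat, `B` affine with LOCAL noetherian ring,
  `G` finite locally free, `Č•(𝓤, G) ⊗ k` exact in degree `1` ⇒ `Γ(X, G)` (= `SecMod G g♯ ⊤`) is a finitely generated
  projective `Γ(B, 𝒪)`-module (★ `exists_strictlyPerfect_quasiIso_cechComplex_of_isProper`, ★ `kerZeroMap_bijective`,
  ★ `kerDZeroEquiv`);
* §2 `finite_and_projective_secMod_top_of_subsingleton_ext` — cover-free: the closed fibre `X₀ = X ×_B B₀` as a cartesian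
  square identified with the residue field, `Ext¹(𝒪_{X₀}, G|_{X₀}) = 0` (★ `function_exact_baseChange_residueField_of_subsingleton_ext`);
* §3 `finite_and_projective_tensor_secMod_top_atPrime` — over an affine noetherian `Spec A`, at a prime `𝔭` with a fibre square
  `X_𝔭 = X ×_A κ(𝔭)` and `Ext¹(𝒪_{X_𝔭}, G|_{X_𝔭}) = 0`: `Γ(Spec A_𝔭, 𝒪) ⊗ Γ(X, G)` is finite projective over `Γ(Spec A_𝔭, 𝒪)` (flat
  base change ★ `Modules.exists_tensor_secMod_top_linearEquiv_of_flat` to `X ×_A A_𝔭`, whose closed fibre is `X_𝔭`, + §2);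
* §4 **`finite_and_projective_secMod_top_of_forall_prime`** / **`…_of_forall_fiber`** — `f : X → Spec A` proper flat, `A`
  noetherian, `G` finite locally free, `Ext¹ = 0` on the fibre at EVERY prime (resp. on every canonical fibre `f.fiber y`) ⇒
  `Γ(X, G)` is a finitely generated projective `Γ(Spec A, 𝒪)`-module (finiteness = the proper coherent finiteness theorem ★
  `moduleFinite_msections_of_coh`; projectivity is local at the maximal ideals, Mathlib `Module.projective_of_localization_maximal'`).

Everything is proved; theorems only (the `private` lemmas are ring bookkeeping for `Spec A_𝔭` / `Spec κ` and transport of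
`Ext¹`-vanishing along an isomorphism); no instance, notation, named fact.  Universe `Scheme.{0}` (as the G-chain).  Cell
`hodgecm-mathlib`, F-DAG F-6 (VI) assembler FILE A (B-p04 (g20), B-plan1 (g16) 07:42:19Z): the local-freeness input «`π_*L` is
finite locally free» of MFK Prop. 7.3 step (VI) / Prop. 6.13, consumed by `Modules/PushforwardHasRankOfFibreVanishing`.  HC_CM is
proved only modulo the 7 printed citations until rung 0 closes — nothing here bears on a summit statement.

## References

* D. Mumford, *Abelian Varieties*, TIFR Studies in Mathematics 5 (1970), §5, Cor. 2 (p. 50), Cor. 3 (p. 53). [MumfordAV1970]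
* R. Hartshorne, *Algebraic Geometry*, GTM 52 (1977), III Thm. 12.11 (p. 290). [Hartshorne1977]
* A. Grothendieck, EGA III₂ (Publ. Math. IHÉS 17, 1963), 7.8.4. [EGAIII2]
* The Stacks Project, Tag 02KH (flat base change). [StacksProject]
-/

noncomputable section

set_option backward.isDefEq.respectTransparency false

open CategoryTheory CategoryTheory.Limits CategoryTheory.Abelian Opposite TopologicalSpace AlgebraicGeometry TensorProduct
open Literature.Algebra.Homology Literature.Algebra.Module

namespace Literature.AlgebraicGeometry.Morphisms

open Literature.AlgebraicGeometry.Modules Literature.AlgebraicGeometry.HodgeTheory Literature.AlgebraicGeometry.Motives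

/-! ## §1 The local base: `Γ(X, G)` is finite projective over the local ring `Γ(B, 𝒪_B)` -/

section Local

variable {X B : Scheme.{0}} (g : X ⟶ B) [IsAffine B] [IsProper g] [IsLocallyNoetherian B] [Flat g]
  [IsLocalRing Γ(B, ⊤)]
  {ι : Type} [LinearOrder ι] [Fintype ι] (U : ι → X.Opens) (hcov : ⨆ i, U i = ⊤)
  (hUa : ∀ s : Finset ι, s.Nonempty → IsAffineOpen (cechOpen U s)) (G : X.Modules) (hL : IsFiniteLocallyFree G)
  (hfib : Function.Exact
    (((cechComplex U G g.appTop.hom).d 0 1).hom.baseChange (IsLocalRing.ResidueField Γ(B, ⊤)))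
    (((cechComplex U G g.appTop.hom).d 1 2).hom.baseChange (IsLocalRing.ResidueField Γ(B, ⊤))))

include hcov hUa hL hfib in
/-- **`Γ(X, G)` is a finitely generated projective `Γ(B, 𝒪_B)`-module** over the LOCAL base, from the degree-`1` fibre
exactness of the Čech complex alone (Mumford §5 Cor. 2 on the strictly perfect Grothendieck model ★
`exists_strictlyPerfect_quasiIso_cechComplex_of_isProper`, ★ `kerBaseChange_of_exact_residueField_one_complex`, transported
along `Z⁰(K•) ≃ Z⁰(Č•) ≃ Γ(X, G)` (★ `kerZeroMap_bijective`, ★ `kerDZeroEquiv`)).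
[cite: MumfordAV1970, §5 Cor. 2 (p. 50)] [cite: Hartshorne1977, III Thm. 12.11 (p. 290)] -/
theorem finite_and_projective_secMod_top_of_exact_one :
    Module.Finite Γ(B, ⊤) (SecMod G g.appTop.hom ⊤) ∧ Module.Projective Γ(B, ⊤) (SecMod G g.appTop.hom ⊤) := by
  obtain ⟨K, ψ, hψ, hGE, hLE, hK⟩ :=
    exists_strictlyPerfect_quasiIso_cechComplex_of_isProper g U hcov hUa G hL (Fintype.card ι) (by omega)
  haveI := hψ
  haveI := hGE
  haveI := hLE
  haveI : (cechComplex U G g.appTop.hom).IsStrictlyLE (Fintype.card ι : ℤ) :=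
    isStrictlyLE_cechComplex U G _ (Fintype.card ι) (by omega)
  haveI : (cechComplex U G g.appTop.hom).IsStrictlyGE 0 := isStrictlyGE_cechComplex U G _
  have hKf := flat_X_of_finite_projective hK
  have hC := flat_cechComplex_X U G _ (flat_secMod_of_flat g U hUa G hL)
  have hfib' : Function.Exact
      (((cechComplex U G g.appTop.hom).d (1 - 1) 1).hom.baseChange (IsLocalRing.ResidueField Γ(B, ⊤)))
      (((cechComplex U G g.appTop.hom).d 1 (1 + 1)).hom.baseChange (IsLocalRing.ResidueField Γ(B, ⊤))) := hfib
  have hfibK : Function.Exact ((K.d 0 1).hom.baseChange (IsLocalRing.ResidueField Γ(B, ⊤)))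
      ((K.d 1 2).hom.baseChange (IsLocalRing.ResidueField Γ(B, ⊤))) :=
    (function_exact_baseChange_iff_of_quasiIso ψ hKf hC (Fintype.card ι : ℤ) _ 1).2 hfib'
  obtain ⟨⟨hfin, hproj⟩, -, -⟩ := kerBaseChange_of_exact_residueField_one_complex K hK hfibK
  -- `ker d⁰_K ≃ ker d⁰_Č ≃ Γ(X, G)`
  have hd : ((cechComplex U G g.appTop.hom).d 0 1).hom = OrderedCech.sysD (sectionsSystem U G g.appTop.hom) 0 := by
    change ((cechComplex U G g.appTop.hom).d 0 (0 + 1)).hom = _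
    rw [OrderedCech.sysComplex_d]
    rfl
  let E₁ : LinearMap.ker (K.d 0 1).hom ≃ₗ[Γ(B, ⊤)] LinearMap.ker ((cechComplex U G g.appTop.hom).d 0 1).hom :=
    LinearEquiv.ofBijective (kerZeroMap ψ) (kerZeroMap_bijective ψ)
  let E₂ : LinearMap.ker ((cechComplex U G g.appTop.hom).d 0 1).hom ≃ₗ[Γ(B, ⊤)]
      LinearMap.ker (OrderedCech.sysD (sectionsSystem U G g.appTop.hom) 0) :=
    LinearEquiv.ofEq _ _ (by rw [hd])
  let E : LinearMap.ker (K.d 0 1).hom ≃ₗ[Γ(B, ⊤)] SecMod G g.appTop.hom ⊤ :=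
    E₁.trans (E₂.trans (kerDZeroEquiv U G g.appTop.hom hcov).symm)
  haveI := hfin
  haveI := hproj
  exact ⟨Module.Finite.equiv E, Module.Projective.of_equiv E⟩

end Local

/-! ## §2 Cover-free headline: the closed fibre as a cartesian square identified with the residue field -/

section Headline

variable {X B : Scheme.{0}} (g : X ⟶ B) [IsAffine B] [IsProper g] [IsLocallyNoetherian B] [Flat g]
  [IsLocalRing Γ(B, ⊤)] (G : X.Modules) (hL : IsFiniteLocallyFree G)
  {X₀ B₀ : Scheme.{0}} {g₀ : X₀ ⟶ B₀} {k₀ : X₀ ⟶ X} {j₀ : B₀ ⟶ B} [IsAffine B₀] (H₀ : IsPullback k₀ g₀ g j₀)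
  (e₀ : letI := (j₀.appLE ⊤ ⊤ le_top).hom.toAlgebra
    IsLocalRing.ResidueField Γ(B, ⊤) ≃ₗ[Γ(B, ⊤)] Γ(B₀, ⊤))
  (hvan : Subsingleton (Ext.{1} (unitModule X₀) ((Scheme.Modules.pullback k₀).obj G) 1))

include H₀ e₀ hvan hL in
/-- **`Γ(X, G)` IS FINITE PROJECTIVE FROM `H¹` OF THE CLOSED FIBRE** (Mumford §5 Cor. 2 / Hartshorne III 12.11 (b) at
`i = 1` then `i = 0`): `g : X → B` proper flat, `B` affine with LOCAL noetherian ring, `G` finite locally free,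
`X₀ = X ×_B B₀` the closed fibre (a cartesian square over an affine `j₀` identified with the residue field by `e₀`) with
`Ext¹(𝒪_{X₀}, G|_{X₀}) = 0`.  Then `Γ(X, G)` is a finitely generated projective (= free) `Γ(B, 𝒪_B)`-module.
[cite: MumfordAV1970, §5 Cor. 2 (p. 50)] [cite: Hartshorne1977, III Thm. 12.11 (p. 290)] -/
theorem finite_and_projective_secMod_top_of_subsingleton_ext :
    Module.Finite Γ(B, ⊤) (SecMod G g.appTop.hom ⊤) ∧ Module.Projective Γ(B, ⊤) (SecMod G g.appTop.hom ⊤) := by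
  obtain ⟨ι, _, _, U, hcov, hUa⟩ := exists_finite_affine_cover_cechOpen g
  haveI := hL.isVectorBundle.1
  have hG : IsAffineLocalizing G := IsAffineLocalizing.of_isQuasicoherent G
  exact finite_and_projective_secMod_top_of_exact_one g U hcov hUa G hL
    (function_exact_baseChange_residueField_of_subsingleton_ext g G H₀ e₀ hvan U hcov hUa hG)

end Headline


/-! ## §3 The affine noetherian base `Spec A`: localisation at the primes -/

section LocalBookkeeping

/-- `Γ(Spec R, 𝒪)` is a local ring when `R` is (`Γ(Spec R, 𝒪) ≅ R`, Mathlib `Scheme.ΓSpecIso`).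
[cite: Hartshorne1977, II Prop. 2.2 (p. 71)] -/
theorem isLocalRing_Γ_Spec (R : Type) [CommRing R] [IsLocalRing R] :
    IsLocalRing Γ(Spec (CommRingCat.of R), ⊤) :=
  haveI : Nontrivial Γ(Spec (CommRingCat.of R), ⊤) :=
    (Scheme.ΓSpecIso (CommRingCat.of R)).symm.commRingCatIsoToRingEquiv.injective.nontrivial
  IsLocalRing.of_surjective' (Scheme.ΓSpecIso (CommRingCat.of R)).inv.hom
    (Scheme.ΓSpecIso (CommRingCat.of R)).symm.commRingCatIsoToRingEquiv.surjective

/-- `Spec.map φ` on global sections, in `appLE ⊤ ⊤` form, is `φ` conjugated by `ΓSpecIso : Γ(Spec ·, 𝒪) ≅ ·` (Mathlib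
`Scheme.ΓSpecIso_inv_naturality`). [cite: Hartshorne1977, II Prop. 2.2 (p. 71)] -/
theorem appLE_SpecMap_apply {R S : Type} [CommRing R] [CommRing S] (φ : R →+* S)
    (r : Γ(Spec (CommRingCat.of R), ⊤)) :
    ((Spec.map (CommRingCat.ofHom φ)).appLE ⊤ ⊤ le_top).hom r =
      (Scheme.ΓSpecIso (CommRingCat.of S)).inv (φ ((Scheme.ΓSpecIso (CommRingCat.of R)).hom r)) := by
  have h := Scheme.ΓSpecIso_inv_naturality (CommRingCat.ofHom φ)
  have h' := congrArg (fun ψ => ψ.hom ((Scheme.ΓSpecIso (CommRingCat.of R)).hom r)) h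
  simp only [CommRingCat.hom_comp, RingHom.comp_apply, CommRingCat.hom_ofHom] at h'
  have e1 : (homOfLE (le_top : (⊤ : (Spec (CommRingCat.of S)).Opens) ≤
      (Spec.map (CommRingCat.ofHom φ)) ⁻¹ᵁ ⊤)) = 𝟙 ⊤ := Subsingleton.elim _ _
  change ((Spec.map (CommRingCat.ofHom φ)).app ⊤ ≫
    (Spec (CommRingCat.of S)).presheaf.map (homOfLE le_top).op) r = _
  rw [e1, op_id]
  erw [CategoryTheory.Functor.map_id, Category.comp_id]
  rw [h', Iso.hom_inv_id_apply]

/-- The ring map of `Spec κ(R) → Spec R` on global sections is onto (`R` local). [folklore] -/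
private theorem surjective_appLE_SpecMap_residue' (R : Type) [CommRing R] [IsLocalRing R] :
    Function.Surjective ((Spec.map (CommRingCat.ofHom (IsLocalRing.residue R))).appLE ⊤ ⊤ le_top).hom := by
  intro y
  obtain ⟨x, hx⟩ :=
    (Scheme.ΓSpecIso (CommRingCat.of (IsLocalRing.ResidueField R))).symm.commRingCatIsoToRingEquiv.surjective y
  obtain ⟨r, rfl⟩ := IsLocalRing.residue_surjective x
  obtain ⟨r', rfl⟩ := (Scheme.ΓSpecIso (CommRingCat.of R)).commRingCatIsoToRingEquiv.surjective r
  exact ⟨r', by rw [appLE_SpecMap_apply]; exact hx⟩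

/-- **`Γ(Spec κ(R), 𝒪) ≅ κ(Γ(Spec R, 𝒪))` linearly over `Γ(Spec R, 𝒪)`** (through the ring map of `Spec κ(R) → Spec R`), for
`R` local: the residue field of the local ring `Γ(Spec R, 𝒪) ≅ R` is identified with the global sections of `Spec κ(R)` — the
datum `e₀` of ★ `exists_tensor_secMod_top_linearEquiv_of_subsingleton_ext` for the closed point of `Spec R`.
[cite: Hartshorne1977, II Prop. 2.2 (p. 71)] -/
theorem exists_residueField_linearEquiv_Γ_Spec (R : Type) [CommRing R] [IsLocalRing R] :
    haveI := isLocalRing_Γ_Spec R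
    letI := ((Spec.map (CommRingCat.ofHom (IsLocalRing.residue R))).appLE ⊤ ⊤ le_top).hom.toAlgebra
    Nonempty (IsLocalRing.ResidueField Γ(Spec (CommRingCat.of R), ⊤) ≃ₗ[Γ(Spec (CommRingCat.of R), ⊤)]
      Γ(Spec (CommRingCat.of (IsLocalRing.ResidueField R)), ⊤)) := by
  haveI := isLocalRing_Γ_Spec R
  let φ := ((Spec.map (CommRingCat.ofHom (IsLocalRing.residue R))).appLE ⊤ ⊤ le_top).hom
  letI := φ.toAlgebra
  have hφ : ∀ a ∈ IsLocalRing.maximalIdeal Γ(Spec (CommRingCat.of R), ⊤), φ a = 0 := by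
    intro a ha
    change ((Spec.map (CommRingCat.ofHom (IsLocalRing.residue R))).appLE ⊤ ⊤ le_top).hom a = 0
    rw [appLE_SpecMap_apply]
    have ha' : (Scheme.ΓSpecIso (CommRingCat.of R)).hom a ∈ IsLocalRing.maximalIdeal R := by
      rw [IsLocalRing.mem_maximalIdeal] at ha ⊢
      intro hu
      exact ha (by simpa using hu.map (Scheme.ΓSpecIso (CommRingCat.of R)).inv.hom)
    rw [(IsLocalRing.residue_eq_zero_iff _).2 ha', map_zero]
  let ψ : IsLocalRing.ResidueField Γ(Spec (CommRingCat.of R), ⊤) →+*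
      Γ(Spec (CommRingCat.of (IsLocalRing.ResidueField R)), ⊤) :=
    Ideal.Quotient.lift _ φ hφ
  have hψ : ∀ r, ψ (IsLocalRing.residue _ r) = φ r := fun r => Ideal.Quotient.lift_mk _ _ _
  haveI : Nontrivial Γ(Spec (CommRingCat.of (IsLocalRing.ResidueField R)), ⊤) :=
    (Scheme.ΓSpecIso (CommRingCat.of (IsLocalRing.ResidueField R))).symm.commRingCatIsoToRingEquiv.injective.nontrivial
  have hbij : Function.Bijective ψ :=
    ⟨ψ.injective, Ideal.Quotient.lift_surjective_of_surjective _ hφ (surjective_appLE_SpecMap_residue' R)⟩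
  exact ⟨{ (RingEquiv.ofBijective ψ hbij).toAddEquiv with
    map_smul' := fun c x => by
      obtain ⟨y, rfl⟩ := IsLocalRing.residue_surjective x
      change ψ (c • IsLocalRing.residue _ y) = φ c * ψ (IsLocalRing.residue _ y)
      rw [Algebra.smul_def, IsLocalRing.ResidueField.algebraMap_eq, map_mul, hψ] }⟩

/-- `Ext¹(𝒪, ·) = 0` transports along an isomorphism of modules. [folklore] -/
private theorem subsingleton_ext_one_of_iso {Y : Scheme.{0}} {M N : Y.Modules} (Φ : M ≅ N)
    (h : Subsingleton (Ext.{1} (unitModule Y) M 1)) : Subsingleton (Ext.{1} (unitModule Y) N 1) := by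
  refine ⟨fun x y => ?_⟩
  have key : ∀ z : Ext.{1} (unitModule Y) N 1,
      z = (z.comp (Ext.mk₀ Φ.inv) (add_zero 1)).comp (Ext.mk₀ Φ.hom) (add_zero 1) := fun z => by
    rw [Ext.comp_assoc_of_second_deg_zero, Ext.mk₀_comp_mk₀, Iso.inv_hom_id, Ext.comp_mk₀_id]
  rw [key x, key y, Subsingleton.elim (x.comp _ _) (y.comp (Ext.mk₀ Φ.inv) (add_zero 1))]

/-- **`Γ(Spec A_𝔭, 𝒪)` is the localization of `Γ(Spec A, 𝒪)` at the prime `P` corresponding to `𝔭`** (`𝔭 = P ∩ A` read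
through `ΓSpecIso : Γ(Spec A, 𝒪) ≅ A`), for the algebra structure through `Spec A_𝔭 → Spec A` (Mathlib
`IsLocalization.isLocalization_of_base_ringEquiv`, `isLocalization_of_algEquiv`). [cite: Hartshorne1977, II Prop. 2.2 (p. 71)] -/
theorem isLocalization_atPrime_Γ_Spec {A : Type} [CommRing A] (P : Ideal Γ(Spec (CommRingCat.of A), ⊤))
    [P.IsPrime] :
    letI := ((Spec.map (CommRingCat.ofHom (algebraMap A (Localization.AtPrime
      (P.comap (Scheme.ΓSpecIso (CommRingCat.of A)).symm.commRingCatIsoToRingEquiv.toRingHom))))).appLE ⊤ ⊤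
        le_top).hom.toAlgebra
    IsLocalization.AtPrime (Γ(Spec (CommRingCat.of (Localization.AtPrime
      (P.comap (Scheme.ΓSpecIso (CommRingCat.of A)).symm.commRingCatIsoToRingEquiv.toRingHom))), ⊤)) P := by
  let φ₀ : A ≃+* Γ(Spec (CommRingCat.of A), ⊤) := (Scheme.ΓSpecIso (CommRingCat.of A)).symm.commRingCatIsoToRingEquiv
  let 𝔭 : Ideal A := P.comap φ₀.toRingHom
  change letI := ((Spec.map (CommRingCat.ofHom (algebraMap A (Localization.AtPrime 𝔭)))).appLE ⊤ ⊤ le_top).hom.toAlgebra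
    IsLocalization P.primeCompl Γ(Spec (CommRingCat.of (Localization.AtPrime 𝔭)), ⊤)
  letI algL : Algebra Γ(Spec (CommRingCat.of A), ⊤) Γ(Spec (CommRingCat.of (Localization.AtPrime 𝔭)), ⊤) :=
    ((Spec.map (CommRingCat.ofHom (algebraMap A (Localization.AtPrime 𝔭)))).appLE ⊤ ⊤ le_top).hom.toAlgebra
  -- `A_𝔭` as an algebra over `Γ(Spec A, 𝒪)` through `φ₀⁻¹`: a localization at `φ₀(A ∖ 𝔭) = Γ(Spec A, 𝒪) ∖ P`
  letI algA : Algebra Γ(Spec (CommRingCat.of A), ⊤) (Localization.AtPrime 𝔭) :=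
    ((algebraMap A (Localization.AtPrime 𝔭)).comp φ₀.symm.toRingHom).toAlgebra
  haveI h1 : IsLocalization (𝔭.primeCompl.map φ₀) (Localization.AtPrime 𝔭) :=
    IsLocalization.isLocalization_of_base_ringEquiv 𝔭.primeCompl (Localization.AtPrime 𝔭) φ₀
  have hmap : 𝔭.primeCompl.map φ₀ = P.primeCompl := by
    ext x
    simp only [Submonoid.mem_map, Ideal.mem_primeCompl_iff]
    constructor
    · rintro ⟨a, ha, rfl⟩
      exact fun h => ha (Ideal.mem_comap.mpr h)
    · intro hx
      refine ⟨φ₀.symm x, fun h => hx ?_, φ₀.apply_symm_apply x⟩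
      have h' := Ideal.mem_comap.mp h
      change φ₀.toRingHom (φ₀.symm x) ∈ P at h'
      rwa [RingEquiv.toRingHom_eq_coe, RingEquiv.coe_toRingHom, RingEquiv.apply_symm_apply] at h'
  rw [hmap] at h1
  -- transport along `ΓSpecIso : Γ(Spec A_𝔭, 𝒪) ≅ A_𝔭`
  let e : Localization.AtPrime 𝔭 ≃ₐ[Γ(Spec (CommRingCat.of A), ⊤)]
      Γ(Spec (CommRingCat.of (Localization.AtPrime 𝔭)), ⊤) :=
    { (Scheme.ΓSpecIso (CommRingCat.of (Localization.AtPrime 𝔭))).symm.commRingCatIsoToRingEquiv with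
      commutes' := fun r => by
        change (Scheme.ΓSpecIso (CommRingCat.of (Localization.AtPrime 𝔭))).inv
            (algebraMap A (Localization.AtPrime 𝔭) (φ₀.symm r)) =
          ((Spec.map (CommRingCat.ofHom (algebraMap A (Localization.AtPrime 𝔭)))).appLE ⊤ ⊤ le_top).hom r
        rw [appLE_SpecMap_apply]
        rfl }
  exact IsLocalization.isLocalization_of_algEquiv P.primeCompl e

end LocalBookkeeping

section AtPrime

/-- **The local step at a prime `𝔭 ⊂ A`**: for `f : X → Spec A` proper flat (`A` noetherian), `G` finite locally free and a
fibre square `X₀ = X ×_A κ(𝔭)` with `Ext¹(𝒪_{X₀}, G|_{X₀}) = 0`, the base change `Γ(Spec A_𝔭, 𝒪) ⊗_{Γ(Spec A, 𝒪)} Γ(X, G)`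
is a finitely generated projective `Γ(Spec A_𝔭, 𝒪)`-module: it is `Γ(X ×_A A_𝔭, G)` by FLAT base change (★
`Modules.exists_tensor_secMod_top_linearEquiv_of_flat`), and the latter is finite projective over the local base by §2, the
closed fibre of `X ×_A A_𝔭 → Spec A_𝔭` being `X₀` (`κ(𝔭)` is the residue field of `A_𝔭`).
[cite: MumfordAV1970, §5 Cor. 2 (p. 50)] [cite: Hartshorne1977, III Thm. 12.11 (p. 290)] [cite: StacksProject, Tag 02KH] -/
theorem finite_and_projective_tensor_secMod_top_atPrime {A : Type} [CommRing A] [IsNoetherianRing A] {X : Scheme.{0}}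
    (f : X ⟶ Spec (CommRingCat.of A)) [IsProper f] [Flat f] (G : X.Modules) (hL : IsFiniteLocallyFree G)
    (𝔭 : Ideal A) [𝔭.IsPrime] {X₀ : Scheme.{0}} {iX : X₀ ⟶ X} {f₀ : X₀ ⟶ Spec (CommRingCat.of 𝔭.ResidueField)}
    (HX : IsPullback iX f₀ f (Spec.map (CommRingCat.ofHom (algebraMap A 𝔭.ResidueField))))
    (hvan : Subsingleton (Ext.{1} (unitModule X₀) ((Scheme.Modules.pullback iX).obj G) 1)) :
    letI := ((Spec.map (CommRingCat.ofHom (algebraMap A (Localization.AtPrime 𝔭)))).appLE ⊤ ⊤ le_top).hom.toAlgebra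
    Module.Finite Γ(Spec (CommRingCat.of (Localization.AtPrime 𝔭)), ⊤)
        (Γ(Spec (CommRingCat.of (Localization.AtPrime 𝔭)), ⊤) ⊗[Γ(Spec (CommRingCat.of A), ⊤)]
          SecMod G f.appTop.hom ⊤) ∧
      Module.Projective Γ(Spec (CommRingCat.of (Localization.AtPrime 𝔭)), ⊤)
        (Γ(Spec (CommRingCat.of (Localization.AtPrime 𝔭)), ⊤) ⊗[Γ(Spec (CommRingCat.of A), ⊤)]
          SecMod G f.appTop.hom ⊤) := by
  -- the local base `Spec A_𝔭` and its closed point `Spec κ(𝔭)`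
  let Ap : Type := Localization.AtPrime 𝔭
  let jl : Spec (CommRingCat.of Ap) ⟶ Spec (CommRingCat.of A) := Spec.map (CommRingCat.ofHom (algebraMap A Ap))
  letI algL : Algebra Γ(Spec (CommRingCat.of A), ⊤) Γ(Spec (CommRingCat.of Ap), ⊤) := (jl.appLE ⊤ ⊤ le_top).hom.toAlgebra
  change Module.Finite Γ(Spec (CommRingCat.of Ap), ⊤)
      (Γ(Spec (CommRingCat.of Ap), ⊤) ⊗[Γ(Spec (CommRingCat.of A), ⊤)] SecMod G f.appTop.hom ⊤) ∧
    Module.Projective Γ(Spec (CommRingCat.of Ap), ⊤)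
      (Γ(Spec (CommRingCat.of Ap), ⊤) ⊗[Γ(Spec (CommRingCat.of A), ⊤)] SecMod G f.appTop.hom ⊤)
  let j₀ : Spec (CommRingCat.of 𝔭.ResidueField) ⟶ Spec (CommRingCat.of Ap) :=
    Spec.map (CommRingCat.ofHom (IsLocalRing.residue Ap))
  have hbot : j₀ ≫ jl = Spec.map (CommRingCat.ofHom (algebraMap A 𝔭.ResidueField)) := by
    change Spec.map _ ≫ Spec.map _ = _
    rw [← Spec.map_comp, ← CommRingCat.ofHom_comp]
    rfl
  -- `X ×_A A_𝔭`, proper and flat over the local base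
  let kl : pullback f jl ⟶ X := pullback.fst f jl
  let gl : pullback f jl ⟶ Spec (CommRingCat.of Ap) := pullback.snd f jl
  have Hl : IsPullback kl gl f jl := IsPullback.of_hasPullback f jl
  haveI : IsProper gl := MorphismProperty.pullback_snd (P := @IsProper) f jl inferInstance
  haveI : Flat gl := MorphismProperty.pullback_snd (P := @Flat) f jl inferInstance
  haveI : IsLocalRing Γ(Spec (CommRingCat.of Ap), ⊤) := isLocalRing_Γ_Spec Ap
  -- the fibre square sits over the closed point of the local base
  have HX' : IsPullback iX f₀ f (j₀ ≫ jl) := by rw [hbot]; exact HX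
  let k₀ : X₀ ⟶ pullback f jl := pullback.lift iX (f₀ ≫ j₀) (by rw [Category.assoc, hbot]; exact HX.w)
  have hk₀ : k₀ ≫ kl = iX := pullback.lift_fst _ _ _
  have hk₀' : k₀ ≫ gl = f₀ ≫ j₀ := pullback.lift_snd _ _ _
  have H₀ : IsPullback k₀ f₀ gl j₀ := IsPullback.of_right (by rw [hk₀]; exact HX') hk₀' Hl
  -- the vector bundle on `X ×_A A_𝔭`, the residue-field identification, the transported vanishing
  let Gl : (pullback f jl).Modules := (Scheme.Modules.pullback kl).obj G
  have hLl : IsFiniteLocallyFree Gl := hL.pullback kl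
  obtain ⟨e₀⟩ := exists_residueField_linearEquiv_Γ_Spec Ap
  have hvan' : Subsingleton (Ext.{1} (unitModule X₀) ((Scheme.Modules.pullback k₀).obj Gl) 1) :=
    subsingleton_ext_one_of_iso
      ((Scheme.Modules.pullbackCongr hk₀.symm).app G ≪≫ ((Scheme.Modules.pullbackComp k₀ kl).app G).symm) hvan
  -- (1) over the local base: `Γ(X ×_A A_𝔭, G)` is finite projective (§2)
  obtain ⟨hfinl, hprojl⟩ := finite_and_projective_secMod_top_of_subsingleton_ext gl Gl hLl H₀ e₀ hvan'
  -- (2) flat base change along `Spec A_𝔭 → Spec A`: `Γ(A_𝔭) ⊗_{Γ(A)} Γ(X, G) ≃ Γ(X ×_A A_𝔭, G)`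
  obtain ⟨ι, _, _, U, hcov, hUa⟩ := exists_finite_affine_cover_cechOpen f
  haveI := hL.isVectorBundle.1
  have hG : IsAffineLocalizing G := IsAffineLocalizing.of_isQuasicoherent G
  haveI : Flat jl := by
    change Flat (Spec.map (CommRingCat.ofHom (algebraMap A Ap)))
    rw [HasRingHomProperty.Spec_iff (P := @Flat)]
    change (algebraMap A Ap).Flat
    rw [RingHom.flat_algebraMap_iff]
    exact IsLocalization.flat Ap 𝔭.primeCompl
  have hflat : (jl.appLE ⊤ ⊤ le_top).hom.Flat :=
    HasRingHomProperty.appLE (P := @Flat) jl inferInstance ⟨⊤, isAffineOpen_top _⟩ ⟨⊤, isAffineOpen_top _⟩ le_top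
  obtain ⟨E₁, -⟩ := exists_tensor_secMod_top_linearEquiv_of_flat Hl U hcov hUa G hG hflat
  haveI := hfinl
  haveI := hprojl
  exact ⟨Module.Finite.equiv E₁.symm, Module.Projective.of_equiv E₁.symm⟩

end AtPrime


/-! ## §4 The affine noetherian base: `Γ(X, G)` is finite projective from `H¹`-vanishing at every prime -/

section Global

/-- **`Γ(X, G)` IS A FINITELY GENERATED PROJECTIVE `Γ(Spec A, 𝒪)`-MODULE, from `H¹`-vanishing on the fibre at every prime**
(Mumford §5 Cor. 2 / Hartshorne III 12.11 (b) / EGA III 7.8.4 (d), in degree `0`, over an arbitrary affine noetherian base):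
`f : X → Spec A` proper flat, `A` noetherian, `G` finite locally free, `X_𝔭 = X ×_A κ(𝔭)` (any cartesian squares `HX`) with
`Ext¹(𝒪_{X_𝔭}, G|_{X_𝔭}) = 0` for every prime `𝔭`.  Proof: finiteness is the proper coherent finiteness theorem (★
`moduleFinite_msections_of_coh`); projectivity is local at the maximal ideals (Mathlib `Module.projective_of_localization_maximal'`)
and at `𝔭` it is §3 (`finite_and_projective_tensor_secMod_top_atPrime`: flat base change to `Spec A_𝔭` + §2 over the local base).
[cite: MumfordAV1970, §5 Cor. 2 (p. 50)] [cite: Hartshorne1977, III Thm. 12.11 (p. 290)] [cite: EGAIII2, 7.8.4] -/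
theorem finite_and_projective_secMod_top_of_forall_prime {A : Type} [CommRing A] [IsNoetherianRing A] {X : Scheme.{0}}
    (f : X ⟶ Spec (CommRingCat.of A)) [IsProper f] [Flat f] (G : X.Modules) (hL : IsFiniteLocallyFree G)
    {X₀ : ∀ (𝔭 : Ideal A) [𝔭.IsPrime], Scheme.{0}} (iX : ∀ (𝔭 : Ideal A) [𝔭.IsPrime], X₀ 𝔭 ⟶ X)
    (f₀ : ∀ (𝔭 : Ideal A) [𝔭.IsPrime], X₀ 𝔭 ⟶ Spec (CommRingCat.of 𝔭.ResidueField))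
    (HX : ∀ (𝔭 : Ideal A) [𝔭.IsPrime],
      IsPullback (iX 𝔭) (f₀ 𝔭) f (Spec.map (CommRingCat.ofHom (algebraMap A 𝔭.ResidueField))))
    (hvan : ∀ (𝔭 : Ideal A) [𝔭.IsPrime],
      Subsingleton (Ext.{1} (unitModule (X₀ 𝔭)) ((Scheme.Modules.pullback (iX 𝔭)).obj G) 1)) :
    Module.Finite Γ(Spec (CommRingCat.of A), ⊤) (SecMod G f.appTop.hom ⊤) ∧
      Module.Projective Γ(Spec (CommRingCat.of A), ⊤) (SecMod G f.appTop.hom ⊤) := by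
  -- finiteness: `Γ(X, G)` is a finite `A`-module (proper coherent finiteness), read over `Γ(Spec A, 𝒪) ≅ A`
  haveI := hL.isVectorBundle.1
  have hG : Coh G := coh_of_isVectorBundle hL.isVectorBundle
  haveI : Module.Finite A (MSections f G ⊤) := moduleFinite_msections_of_coh f hG
  haveI hfin : Module.Finite Γ(Spec (CommRingCat.of A), ⊤) (SecMod G f.appTop.hom ⊤) :=
    Module.Finite.of_addEquiv_semilinear (M := SecMod G f.appTop.hom ⊤) (N := MSections f G ⊤)
      (Scheme.ΓSpecIso (CommRingCat.of A)).hom.hom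
      (Scheme.ΓSpecIso (CommRingCat.of A)).commRingCatIsoToRingEquiv.surjective (AddEquiv.refl _) (fun c x => by
        change toSections f.appTop.hom ⊤ c • SecMod.val (L := G) (ρ := f.appTop.hom) x =
          (show Γ(X, ⊤) from algebraMap A (Sections f ⊤) ((Scheme.ΓSpecIso (CommRingCat.of A)).hom c)) •
            SecMod.val (L := G) (ρ := f.appTop.hom) x
        rw [Sections.algebraMap_apply]
        congr 1
        change X.presheaf.map (homOfLE le_top).op (f.appTop c) =
          X.presheaf.map (homOfLE le_top).op (f.appTop ((Scheme.ΓSpecIso (CommRingCat.of A)).inv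
            ((Scheme.ΓSpecIso (CommRingCat.of A)).hom c)))
        rw [Iso.hom_inv_id_apply])
  refine ⟨hfin, ?_⟩
  haveI : IsNoetherianRing Γ(Spec (CommRingCat.of A), ⊤) :=
    IsLocallyNoetherian.component_noetherian ⟨⊤, isAffineOpen_top _⟩
  haveI : Module.FinitePresentation Γ(Spec (CommRingCat.of A), ⊤) (SecMod G f.appTop.hom ⊤) :=
    Module.finitePresentation_of_finite _ _
  -- projectivity is local at the maximal ideals `P` of `R = Γ(Spec A, 𝒪)`; at `P` use §3 with `𝔭 = P ∩ A`
  let R : Type := Γ(Spec (CommRingCat.of A), ⊤)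
  let M : Type := SecMod G f.appTop.hom ⊤
  let φ₀ : A →+* R := (Scheme.ΓSpecIso (CommRingCat.of A)).symm.commRingCatIsoToRingEquiv.toRingHom
  -- the local rings `Γ(Spec A_𝔭, 𝒪)`, algebras over `R` through `Spec A_𝔭 → Spec A`, localizations of `R` at `P`
  let algRl : ∀ (P : Ideal R) [P.IsMaximal], Algebra R Γ(Spec (CommRingCat.of (Localization.AtPrime (P.comap φ₀))), ⊤) :=
    fun P _ => ((Spec.map (CommRingCat.ofHom (algebraMap A (Localization.AtPrime (P.comap φ₀))))).appLE ⊤ ⊤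
      le_top).hom.toAlgebra
  change Module.Projective R M
  refine @Module.projective_of_localization_maximal' R M _ _ _
    (fun P _ => Γ(Spec (CommRingCat.of (Localization.AtPrime (P.comap φ₀))), ⊤)) (fun P _ => inferInstance) algRl
    (fun P _ => isLocalization_atPrime_Γ_Spec P)
    (fun P _ => Γ(Spec (CommRingCat.of (Localization.AtPrime (P.comap φ₀))), ⊤) ⊗[R] M) (fun P _ => inferInstance)
    (fun P _ => inferInstance) (fun P _ => by letI := algRl P; infer_instance) (fun P _ => by letI := algRl P; infer_instance)
    (fun P _ => by letI := algRl P; exact TensorProduct.mk R Γ(Spec (CommRingCat.of (Localization.AtPrime (P.comap φ₀))), ⊤) M 1)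
    (fun P _ => by
      letI := algRl P
      haveI : IsLocalization.AtPrime Γ(Spec (CommRingCat.of (Localization.AtPrime (P.comap φ₀))), ⊤) P :=
        isLocalization_atPrime_Γ_Spec P
      exact IsLocalization.tensorProduct_isLocalizedModule _ _)
    (fun P hP => ?_) inferInstance
  letI := algRl P
  exact (finite_and_projective_tensor_secMod_top_atPrime f G hL (P.comap φ₀) (HX _) (hvan _)).2

/-- **The same with Mathlib's canonical fibres** `f.fiber y` (★ `isPullback_fiberι_SpecMap_algebraMap`): `f : X → Spec A`
proper flat, `A` noetherian, `G` finite locally free with `Ext¹(𝒪_{X_y}, G|_{X_y}) = 0` at every point `y` of `Spec A`; then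
`Γ(X, G)` is a finitely generated projective `Γ(Spec A, 𝒪)`-module.
[cite: MumfordAV1970, §5 Cor. 2 (p. 50)] [cite: Hartshorne1977, III Thm. 12.11 (p. 290)] -/
theorem finite_and_projective_secMod_top_of_forall_fiber {A : Type} [CommRing A] [IsNoetherianRing A] {X : Scheme.{0}}
    (f : X ⟶ Spec (CommRingCat.of A)) [IsProper f] [Flat f] (G : X.Modules) (hL : IsFiniteLocallyFree G)
    (hvan : ∀ y : Spec (CommRingCat.of A),
      Subsingleton (Ext.{1} (unitModule (f.fiber y)) ((Scheme.Modules.pullback (f.fiberι y)).obj G) 1)) :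
    Module.Finite Γ(Spec (CommRingCat.of A), ⊤) (SecMod G f.appTop.hom ⊤) ∧
      Module.Projective Γ(Spec (CommRingCat.of A), ⊤) (SecMod G f.appTop.hom ⊤) :=
  finite_and_projective_secMod_top_of_forall_prime f G hL
    (fun (𝔭 : Ideal A) _ => f.fiberι (⟨𝔭, inferInstance⟩ : PrimeSpectrum A))
    (fun (𝔭 : Ideal A) _ => f.fiberToSpecResidueField (⟨𝔭, inferInstance⟩ : PrimeSpectrum A) ≫
      Spec.map (Scheme.Spec.residueFieldIso (CommRingCat.of A) ⟨𝔭, inferInstance⟩).inv)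
    (fun (𝔭 : Ideal A) _ => isPullback_fiberι_SpecMap_algebraMap f ⟨𝔭, inferInstance⟩)
    (fun (𝔭 : Ideal A) _ => hvan ⟨𝔭, inferInstance⟩)

end Global

end Literature.AlgebraicGeometry.Morphisms

end
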